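import Literature.Geometry.Kaehler.ManifoldFormsPullback
import Literature.Analysis.Complex.PQTypes
import HarnessLib

/-!
# Forms on an open subset of the model vector space, read as flat forms

For an open subset `U : TopologicalSpace.Opens E` of a real normed space `E` (with Mathlib's
charted-space structure on `↥U`, charts = restrictions of the identity) a `k`-form
`γ : MForm 𝓘(ℝ, E) U F k` on the manifold `U` is a map `U → (E [⋀^Fin k]→L[ℝ] F)`; its **flat
extension** `flatExt γ : E → E [⋀^Fin k]→L[ℝ] F` (by `0` off `U`) carries the same information,
and the manifold notions of the tree's forms library become the flat ones of Mathlib: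

* `inChart_eventuallyEq_flatExt` — the chart representative of `γ` at `x` agrees with `flatExt γ`
  near `↑x` (the charts of `U` are the inclusion, with identity differential);
* `smoothAt_iff_contDiffAt_flatExt` — `γ` is smooth at `x` iff `flatExt γ` is `C^∞` at `↑x`;
  `isSmoothForm_iff_contDiffOn_flatExt` — `γ` is smooth iff `flatExt γ` is `C^∞` on `U`;
* `mextDeriv_apply_eq_extDeriv_flatExt` — `dγ (x) = d(flatExt γ) (↑x)` (Mathlib's `extDeriv`);
* `flatExt_restrictOpens` — conversely a flat `β : E → E [⋀^Fin k]→L[ℝ] F` restricts to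
  `restrictOpens U β : MForm 𝓘(ℝ, E) U F k`, with `flatExt (restrictOpens U β) = β` on `U`;
* for complex `E` and `F = ℂ`: `isOfType_iff_forall_isOfTypeAt_opens`, `typeComponent_apply_opens`
  (the `(p,q)`-type conditions are pointwise).

This is the (trivial) dictionary "differential forms on an open set `U ⊆ ℝⁿ` = smooth maps
`U → Λ^k(ℝⁿ)^*`" (Warner (1983), 2.15–2.18 with the identity chart; Lee (2013), Prop. 3.9,
`T_pU = T_pM`), needed to feed the flat `∂̄`-results of `Literature/Analysis/Complex/` into the
tree's Dolbeault cohomology of `U` (`Literature/NumberTheory/Transcendental/Dolbeault.lean`).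

## References

* F. W. Warner, *Foundations of Differentiable Manifolds and Lie Groups* (1983), 2.15–2.18.
  [WarnerGTM94]
* J. M. Lee, *Introduction to Smooth Manifolds*, 2nd ed. (2013), Example 1.26, Prop. 3.9. [folklore]
-/

noncomputable section

open scoped Manifold ContDiff Topology
open Set Filter Function
open Literature.Geometry.Kaehler Literature.NumberTheory.Transcendental

namespace Literature.Analysis.Complex

variable {E : Type*} [NormedAddCommGroup E] [NormedSpace ℝ E]
  {F : Type*} [NormedAddCommGroup F] [NormedSpace ℝ F] {k : ℕ}
  {U : TopologicalSpace.Opens E}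

/-! ### The charts of an open subset of the model space -/

/-- The extended chart of `U` at any point is the inclusion `U → E`.
refactor: this and the next lemma are (by `rfl`) the tree's
`Literature.Geometry.Lorentzian.OpensChart.extChartAt_apply` / `extChartAt_coe`
(`Literature/Geometry/Lorentzian/ChartCalculus.lean`), restated here to keep the import closure of
the forms / `∂̄` library free of the Lorentzian theory (same policy as the tree's
`Literature.Geometry.Kaehler.hasMFDerivAt_subtype_val`). [folklore] -/
theorem extChartAt_opens_apply (x y : U) : extChartAt 𝓘(ℝ, E) x y = (y : E) :=
  rfl

/-- The extended chart of `U` at `x`, as a function, is `Subtype.val`. [folklore] -/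
theorem extChartAt_opens_coe (x : U) : ⇑(extChartAt 𝓘(ℝ, E) x) = (Subtype.val : U → E) :=
  rfl

/-- On the target, the inverse extended chart of `U` is the inverse of the inclusion. [folklore] -/
theorem coe_extChartAt_opens_symm (x : U) {y : E} (hy : y ∈ (extChartAt 𝓘(ℝ, E) x).target) :
    (((extChartAt 𝓘(ℝ, E) x).symm y : U) : E) = y := by
  have h := (extChartAt 𝓘(ℝ, E) x).right_inv hy
  rwa [extChartAt_opens_apply] at h

/-- Points of the target of the chart of `U` lie in `U`. [folklore] -/
theorem mem_of_mem_extChartAt_opens_target (x : U) {y : E}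
    (hy : y ∈ (extChartAt 𝓘(ℝ, E) x).target) : y ∈ U := by
  rw [← coe_extChartAt_opens_symm x hy]
  exact ((extChartAt 𝓘(ℝ, E) x).symm y).2

/-- The target of the chart of `U` at `x` is a neighbourhood of `↑x`. [folklore] -/
theorem extChartAt_opens_target_mem_nhds (x : U) : (extChartAt 𝓘(ℝ, E) x).target ∈ 𝓝 (x : E) := by
  have h := extChartAt_target_mem_nhds (I := 𝓘(ℝ, E)) x
  rwa [extChartAt_opens_apply] at h

/-- The differential of the chart of `U` (the inclusion) is the identity. [folklore] -/
theorem mfderiv_extChartAt_opens (x y : U) :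
    mfderiv 𝓘(ℝ, E) 𝓘(ℝ, E) (extChartAt 𝓘(ℝ, E) x) y = ContinuousLinearMap.id ℝ E := by
  rw [extChartAt_opens_coe]
  exact mfderiv_subtype_val y

/-- The differential of the inverse chart of `U` on the target is the identity. [folklore] -/
theorem mfderivWithin_extChartAt_opens_symm (x : U) {y : E} (hy : y ∈ (extChartAt 𝓘(ℝ, E) x).target) :
    mfderivWithin 𝓘(ℝ, E) 𝓘(ℝ, E) (extChartAt 𝓘(ℝ, E) x).symm (range 𝓘(ℝ, E)) y =
      ContinuousLinearMap.id ℝ E := by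
  have h := mfderiv_extChartAt_comp_mfderivWithin_extChartAt_symm (I := 𝓘(ℝ, E)) hy
  rw [mfderiv_extChartAt_opens] at h
  ext v
  exact DFunLike.congr_fun h v

/-! ### The flat extension of a form on `U` -/

open Classical in
/-- The **flat extension** of a form on the open submanifold `U ⊆ E`: the map `E → Λ^k` equal to
`γ` on `U` and to `0` off `U`. [folklore] -/
def flatExt (γ : MForm 𝓘(ℝ, E) U F k) : E → E [⋀^Fin k]→L[ℝ] F := fun y =>
  if h : y ∈ U then (γ ⟨y, h⟩ : E [⋀^Fin k]→L[ℝ] F) else 0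

/-- On `U` the flat extension is the form. [folklore] -/
@[simp]
theorem flatExt_coe (γ : MForm 𝓘(ℝ, E) U F k) (x : U) : flatExt γ x = (γ x : E [⋀^Fin k]→L[ℝ] F) := by
  simp [flatExt, x.2]

/-- Off `U` the flat extension vanishes. [folklore] -/
theorem flatExt_of_notMem (γ : MForm 𝓘(ℝ, E) U F k) {y : E} (hy : y ∉ U) : flatExt γ y = 0 := by
  simp [flatExt, hy]

/-- The flat extension is additive. [folklore] -/
theorem flatExt_add (γ γ' : MForm 𝓘(ℝ, E) U F k) : flatExt (γ + γ') = flatExt γ + flatExt γ' := by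
  funext y
  by_cases hy : y ∈ U
  · rw [Pi.add_apply, ← show ((⟨y, hy⟩ : U) : E) = y from rfl, flatExt_coe, flatExt_coe, flatExt_coe]
    rfl
  · simp [flatExt_of_notMem _ hy]

/-- The flat extension is homogeneous. [folklore] -/
theorem flatExt_smul (c : ℝ) (γ : MForm 𝓘(ℝ, E) U F k) : flatExt (c • γ) = c • flatExt γ := by
  funext y
  by_cases hy : y ∈ U
  · rw [Pi.smul_apply, ← show ((⟨y, hy⟩ : U) : E) = y from rfl, flatExt_coe, flatExt_coe]
    rfl
  · simp [flatExt_of_notMem _ hy]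

/-- **The restriction of a flat form to `U`** (the pull-back along the inclusion, whose
differential is the identity). [folklore] -/
def restrictOpens (U : TopologicalSpace.Opens E) (β : E → E [⋀^Fin k]→L[ℝ] F) : MForm 𝓘(ℝ, E) U F k :=
  fun x => β x

/-- Values of the restriction. [folklore] -/
@[simp]
theorem restrictOpens_apply (β : E → E [⋀^Fin k]→L[ℝ] F) (x : U) :
    (restrictOpens U β x : E [⋀^Fin k]→L[ℝ] F) = β x :=
  rfl

/-- The flat extension of a restriction agrees with the original on `U`. [folklore] -/
theorem flatExt_restrictOpens_of_mem (β : E → E [⋀^Fin k]→L[ℝ] F) {y : E} (hy : y ∈ U) :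
    flatExt (restrictOpens U β) y = β y := by
  rw [← show ((⟨y, hy⟩ : U) : E) = y from rfl, flatExt_coe]
  rfl

/-- Near a point of `U` the flat extension of a restriction is the original. [folklore] -/
theorem flatExt_restrictOpens_eventuallyEq (β : E → E [⋀^Fin k]→L[ℝ] F) (x : U) :
    flatExt (restrictOpens U β) =ᶠ[𝓝 (x : E)] β :=
  Filter.eventuallyEq_of_mem (U.isOpen.mem_nhds x.2) fun _ hy => flatExt_restrictOpens_of_mem β hy

/-- Restricting the flat extension gives back the form. [folklore] -/
@[simp]
theorem restrictOpens_flatExt (γ : MForm 𝓘(ℝ, E) U F k) : restrictOpens U (flatExt γ) = γ := by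
  funext x
  exact flatExt_coe γ x

/-! ### Chart representatives, smoothness and `d` through the flat extension -/

/-- **The chart representative of a form on `U` is its flat extension** on the target of the
chart (the chart is the inclusion and its inverse has identity differential). [folklore] -/
theorem inChart_eq_flatExt (γ : MForm 𝓘(ℝ, E) U F k) (x : U) {y : E}
    (hy : y ∈ (extChartAt 𝓘(ℝ, E) x).target) : γ.inChart x y = flatExt γ y := by
  have hyU : y ∈ U := mem_of_mem_extChartAt_opens_target x hy
  have hpt : (extChartAt 𝓘(ℝ, E) x).symm y = ⟨y, hyU⟩ := Subtype.ext (coe_extChartAt_opens_symm x hy)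
  ext v
  rw [MForm.inChart_apply, mfderivWithin_extChartAt_opens_symm x hy, hpt,
    show flatExt γ y = (γ ⟨y, hyU⟩ : E [⋀^Fin k]→L[ℝ] F) from flatExt_coe γ ⟨y, hyU⟩]
  rfl

/-- The chart representative of `γ` at `x` agrees with `flatExt γ` near `↑x`. [folklore] -/
theorem inChart_eventuallyEq_flatExt (γ : MForm 𝓘(ℝ, E) U F k) (x : U) :
    γ.inChart x =ᶠ[𝓝 (x : E)] flatExt γ :=
  Filter.eventuallyEq_of_mem (extChartAt_opens_target_mem_nhds x) fun _ hy =>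
    inChart_eq_flatExt γ x hy

/-- **Smoothness at a point of a form on `U` is `C^∞`-regularity of its flat extension**
(Warner (1983), 2.15 in the identity chart). [cite: WarnerGTM94, 2.15] -/
theorem smoothAt_iff_contDiffAt_flatExt (γ : MForm 𝓘(ℝ, E) U F k) (x : U) :
    γ.SmoothAt x ↔ ContDiffAt ℝ ∞ (flatExt γ) x := by
  rw [MForm.SmoothAt, ModelWithCorners.range_eq_univ, contDiffWithinAt_univ, extChartAt_opens_apply]
  exact ⟨fun h => h.congr_of_eventuallyEq (inChart_eventuallyEq_flatExt γ x).symm,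
    fun h => h.congr_of_eventuallyEq (inChart_eventuallyEq_flatExt γ x)⟩

/-- A form on `U` is smooth iff its flat extension is `C^∞` on `U`. [cite: WarnerGTM94, 2.15] -/
theorem isSmoothForm_iff_contDiffOn_flatExt (γ : MForm 𝓘(ℝ, E) U F k) :
    IsSmoothForm γ ↔ ContDiffOn ℝ ∞ (flatExt γ) U := by
  rw [isSmoothForm_iff_smoothAt, U.isOpen.contDiffOn_iff]
  constructor
  · intro h y hy
    exact (smoothAt_iff_contDiffAt_flatExt γ ⟨y, hy⟩).1 (h ⟨y, hy⟩)
  · intro h x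
    exact (smoothAt_iff_contDiffAt_flatExt γ x).2 (h x.2)

/-- Smoothness at a point of a restricted flat form. [folklore] -/
theorem smoothAt_restrictOpens_iff (β : E → E [⋀^Fin k]→L[ℝ] F) (x : U) :
    (restrictOpens U β).SmoothAt x ↔ ContDiffAt ℝ ∞ β x := by
  rw [smoothAt_iff_contDiffAt_flatExt]
  exact ⟨fun h => h.congr_of_eventuallyEq (flatExt_restrictOpens_eventuallyEq β x).symm,
    fun h => h.congr_of_eventuallyEq (flatExt_restrictOpens_eventuallyEq β x)⟩

/-- A flat form `C^∞` on `U` restricts to a smooth form on `U`. [cite: WarnerGTM94, 2.15] -/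
theorem isSmoothForm_restrictOpens {β : E → E [⋀^Fin k]→L[ℝ] F} (hβ : ContDiffOn ℝ ∞ β U) :
    IsSmoothForm (restrictOpens U β) := fun x =>
  (smoothAt_restrictOpens_iff β x).2 (hβ.contDiffAt (U.isOpen.mem_nhds x.2))

/-- **The exterior derivative of a form on `U` is that of its flat extension**:
`dγ (x) = d(flatExt γ) (↑x)` value-wise (Warner (1983), 2.20 in the identity chart; Mathlib's
`extDeriv`). [cite: WarnerGTM94, Thm. 2.20] -/
theorem mextDeriv_apply_eq_extDeriv_flatExt (γ : MForm 𝓘(ℝ, E) U F k) (x : U) :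
    (mextDeriv γ x : E [⋀^Fin (k + 1)]→L[ℝ] F) = extDeriv (flatExt γ) x := by
  ext v
  change mextDeriv γ x v = _
  simp only [mextDeriv, ContinuousAlternatingMap.compContinuousLinearMap_apply,
    mfderiv_extChartAt_opens]
  rw [ModelWithCorners.range_eq_univ, extDerivWithin_univ, extChartAt_opens_apply,
    (inChart_eventuallyEq_flatExt γ x).extDeriv_eq]
  rfl

/-- The exterior derivative of a restricted flat form. [cite: WarnerGTM94, Thm. 2.20] -/
theorem mextDeriv_restrictOpens_apply (β : E → E [⋀^Fin k]→L[ℝ] F) (x : U) :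
    (mextDeriv (restrictOpens U β) x : E [⋀^Fin (k + 1)]→L[ℝ] F) = extDeriv β x := by
  rw [mextDeriv_apply_eq_extDeriv_flatExt, (flatExt_restrictOpens_eventuallyEq β x).extDeriv_eq]

/-- `d` commutes with restriction: `d(β|_U) = (dβ)|_U` for flat forms. [cite: WarnerGTM94, Thm. 2.20] -/
theorem mextDeriv_restrictOpens (β : E → E [⋀^Fin k]→L[ℝ] F) :
    mextDeriv (restrictOpens U β) = restrictOpens U (extDeriv β) := by
  funext x
  exact mextDeriv_restrictOpens_apply β x

/-- The flat extension of `dγ` agrees with `d(flatExt γ)` on `U`. [folklore] -/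
theorem flatExt_mextDeriv_of_mem (γ : MForm 𝓘(ℝ, E) U F k) {y : E} (hy : y ∈ U) :
    flatExt (mextDeriv γ) y = extDeriv (flatExt γ) y := by
  rw [← show ((⟨y, hy⟩ : U) : E) = y from rfl, flatExt_coe]
  exact mextDeriv_apply_eq_extDeriv_flatExt γ ⟨y, hy⟩

/-! ### Types through the flat extension -/

section Types

variable {E : Type*} [NormedAddCommGroup E] [NormedSpace ℂ E] {U : TopologicalSpace.Opens E} {k : ℕ}

/-- **The type condition is pointwise**: a form on `U` has type `(p,q)` iff `p + q = k` and all
its values have pointwise type `(p,q)`. [cite: Voisin2002, §2.3.1] -/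
theorem isOfType_iff_forall_isOfTypeAt_opens (p q : ℕ) (γ : MForm 𝓘(ℝ, E) U ℂ k) :
    IsOfType p q γ ↔ p + q = k ∧ ∀ x : U, IsOfTypeAt (E := E) p q (γ x) :=
  ⟨fun h => ⟨h.1, fun x => ⟨h.1, fun θ v => h.2 x θ v⟩⟩, fun h => ⟨h.1, fun x θ v => (h.2 x).2 θ v⟩⟩

/-- **The `(p,q)`-component is pointwise**: `(γ^{p,q}) (x) = (γ (x))^{p,q}`.
[cite: Voisin2002, §2.3.1] -/
theorem typeComponent_apply_opens (p q : ℕ) (γ : MForm 𝓘(ℝ, E) U ℂ k) (x : U) :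
    typeProjAt (E := E) p q (γ x) = γ.typeComponent p q x := by
  unfold typeProjAt MForm.typeComponent MForm.weightComponent
  split_ifs <;> rfl

/-- The flat extension of the `(p,q)`-component. [folklore] -/
theorem flatExt_typeComponent (p q : ℕ) (γ : MForm 𝓘(ℝ, E) U ℂ k) :
    flatExt (γ.typeComponent p q) = fun y => typeProjAt p q (flatExt γ y) := by
  funext y
  by_cases hy : y ∈ U
  · rw [← show ((⟨y, hy⟩ : U) : E) = y from rfl, flatExt_coe, flatExt_coe]
    exact (typeComponent_apply_opens p q γ ⟨y, hy⟩).symm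
  · rw [flatExt_of_notMem _ hy, flatExt_of_notMem _ hy, typeProjAt_zero]

/-- A form on `U` of type `(p,q)` has values of pointwise type `(p,q)`; off `U` its flat
extension is `0`, so the flat extension is fixed by the `(p,q)`-projection everywhere. [folklore] -/
theorem IsOfType.typeProjAt_flatExt {p q : ℕ} {γ : MForm 𝓘(ℝ, E) U ℂ k} (h : IsOfType p q γ) (y : E) :
    typeProjAt p q (flatExt γ y) = flatExt γ y := by
  by_cases hy : y ∈ U
  · rw [← show ((⟨y, hy⟩ : U) : E) = y from rfl, flatExt_coe]
    exact (((isOfType_iff_forall_isOfTypeAt_opens p q γ).1 h).2 ⟨y, hy⟩).typeProjAt_eq_self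
  · rw [flatExt_of_notMem _ hy, typeProjAt_zero]

/-- A restricted flat form whose values on `U` have pointwise type `(p,q)` has type `(p,q)`.
[folklore] -/
theorem isOfType_restrictOpens {p q : ℕ} (hpq : p + q = k) {β : E → E [⋀^Fin k]→L[ℝ] ℂ}
    (h : ∀ y ∈ U, IsOfTypeAt p q (β y)) : IsOfType p q (restrictOpens U β) :=
  (isOfType_iff_forall_isOfTypeAt_opens p q _).2 ⟨hpq, fun x => h x x.2⟩

end Types

end Literature.Analysis.Complex
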